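import Summits.CriticalPhenomena.PercolationContinuityZ3.Theorems.PercNearOneGluingAdditiveGluingGoodStepOfGlueStep
import Summits.CriticalPhenomena.PercolationContinuityZ3.Theses.PercNearOneGluing
import HarnessLib

/-! # Crux `PercNearOneGluing.AdditiveGluing` (stmt-CriticalPhenomena-4576) FROM the one-pair gluing step (siege attempt k8)

`additiveGluing_of_glueStep : GlueStep → AdditiveGluing` — the crux BY NAME, conditional on the single
displayed hypothesis `GlueStep` ("DG1": goodness survives gluing one low vertex onto the observer, measured
against the old minimiser; see `…GoodStepOfGlueStep.lean`).  The composition is the real proof of the line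
`subuniform-dead-pocket-maximum` (skeleton `Cruxes/AdditiveGluing/Lines/subuniform-dead-pocket-maximum.lean`,
`good_all` + `AdditiveGluing_of`) with its three stubs discharged by the landed `stub_lemma5AnyRelay`,
`stub_goodBase` and `goodStep_of_glueStep hglue`:  strong induction on the number of positive-degree vertices
gives goodness of every quadruple, then the level-set normal form (KN §5.6(4)) and dropping the nonnegative
dead-pocket penalty give `AdditiveGluing`.  Lands `--supports stmt-CriticalPhenomena-4576`; `GlueStep` is NOT
proved here (numerically solid, see the item evidence `GlueStepReduction-k8.md`).  No new definitions.
-/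

namespace Summit.CriticalPhenomena.PercolationContinuityZ3.Theorems

open MeasureTheory Set
open Literature.Probability.LatticeModels (prodBernoulli)
open Literature.Probability.Percolation (BondConfig openConn openConnIn openGraph openCluster openGraph_adj)
open scoped BigOperators

noncomputable section
open Classical

/-- **Every quadruple is good, given the gluing step** (`b ∈ A`, `o ∉ A`): strong induction on the number of
positive-degree vertices; base `stub_goodBase stub_lemma5AnyRelay` (no low neighbour at `o`), step
`goodStep_of_glueStep hglue`.  (The skeleton's `good_all` with its stubs discharged.) -/
theorem good_all_of_glueStep
    (hglue : ∀ (n : ℕ) (w : Sym2 (Fin n) → unitInterval) (A : Finset (Fin n)) (o x b a₀ : Fin n),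
      b ∈ A → o ∉ A → x ∉ A → x ≠ o → w s(o, x) = 0 → a₀ ∈ A →
      (∀ a ∈ A, (prodBernoulli w).real (openConn a₀ b) ≤ (prodBernoulli w).real (openConn a b)) →
      (∀ (t : ℝ) (sel : Finset (Fin n) → Fin n), (∀ W, sel W ∈ A) →
        (∀ a ∈ A, 1 - t ≤ (prodBernoulli w).real (openConn a b)) →
        ((prodBernoulli w).real ((⋃ a ∈ A, openConn o a) ∩ (openConn o b)ᶜ)
            + ∑ W ∈ (Finset.univ : Finset (Finset (Fin n))).filter (fun W => o ∈ W ∧ Disjoint W A),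
                (prodBernoulli w).real {ω : BondConfig (Fin n) | openCluster ω o = (W : Set (Fin n))}
                  * (prodBernoulli w).real (openConnIn ((W : Set (Fin n))ᶜ) (sel W) b)ᶜ) ≤ t) →
      (∀ w' : Sym2 (Fin n) → unitInterval,
        (Finset.univ.filter (fun v : Fin n => ∃ u : Fin n, 0 < (w' s(u, v) : ℝ))).card < (Finset.univ.filter (fun v : Fin n => ∃ u : Fin n, 0 < (w s(u, v) : ℝ))).card →
        ∀ (A' : Finset (Fin n)) (o' b' : Fin n), b' ∈ A' → o' ∉ A' →
        ∀ (t : ℝ) (sel : Finset (Fin n) → Fin n), (∀ W, sel W ∈ A') →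
          (∀ a ∈ A', 1 - t ≤ (prodBernoulli w').real (openConn a b')) →
          ((prodBernoulli w').real ((⋃ a ∈ A', openConn o' a) ∩ (openConn o' b')ᶜ)
            + ∑ W ∈ (Finset.univ : Finset (Finset (Fin n))).filter (fun W => o' ∈ W ∧ Disjoint W A'),
                (prodBernoulli w').real {ω : BondConfig (Fin n) | openCluster ω o' = (W : Set (Fin n))}
                  * (prodBernoulli w').real (openConnIn ((W : Set (Fin n))ᶜ) (sel W) b')ᶜ) ≤ t) →
      ∀ (sel : Finset (Fin n) → Fin n), (∀ W, sel W ∈ A) →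
        ((prodBernoulli (Function.update w s(o, x) 1)).real ((⋃ a ∈ A, openConn o a) ∩ (openConn o b)ᶜ)
            + ∑ W ∈ (Finset.univ : Finset (Finset (Fin n))).filter (fun W => o ∈ W ∧ Disjoint W A),
                (prodBernoulli (Function.update w s(o, x) 1)).real {ω : BondConfig (Fin n) | openCluster ω o = (W : Set (Fin n))}
                  * (prodBernoulli (Function.update w s(o, x) 1)).real (openConnIn ((W : Set (Fin n))ᶜ) (sel W) b)ᶜ) ≤ 1 - (prodBernoulli (Function.update w s(o, x) 1)).real (openConn a₀ b))
    (n : ℕ) :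
    ∀ (w : Sym2 (Fin n) → unitInterval) (A : Finset (Fin n)) (o b : Fin n),
      b ∈ A → o ∉ A →
      ∀ (t : ℝ) (sel : Finset (Fin n) → Fin n), (∀ W, sel W ∈ A) →
        (∀ a ∈ A, 1 - t ≤ (prodBernoulli w).real (openConn a b)) →
        (prodBernoulli w).real ((⋃ a ∈ A, openConn o a) ∩ (openConn o b)ᶜ)
          + ∑ W ∈ (Finset.univ : Finset (Finset (Fin n))).filter (fun W => o ∈ W ∧ Disjoint W A),
              (prodBernoulli w).real {ω : BondConfig (Fin n) | openCluster ω o = (W : Set (Fin n))}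
                * (prodBernoulli w).real (openConnIn ((W : Set (Fin n))ᶜ) (sel W) b)ᶜ
          ≤ t := by
  suffices h : ∀ (k : ℕ) (w : Sym2 (Fin n) → unitInterval),
      (Finset.univ.filter (fun v : Fin n => ∃ u : Fin n, 0 < (w s(u, v) : ℝ))).card = k →
      ∀ (A : Finset (Fin n)) (o b : Fin n), b ∈ A → o ∉ A →
      ∀ (t : ℝ) (sel : Finset (Fin n) → Fin n), (∀ W, sel W ∈ A) →
        (∀ a ∈ A, 1 - t ≤ (prodBernoulli w).real (openConn a b)) →
        (prodBernoulli w).real ((⋃ a ∈ A, openConn o a) ∩ (openConn o b)ᶜ)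
          + ∑ W ∈ (Finset.univ : Finset (Finset (Fin n))).filter (fun W => o ∈ W ∧ Disjoint W A),
              (prodBernoulli w).real {ω : BondConfig (Fin n) | openCluster ω o = (W : Set (Fin n))}
                * (prodBernoulli w).real (openConnIn ((W : Set (Fin n))ᶜ) (sel W) b)ᶜ
          ≤ t by
    intro w A o b hb ho
    exact h _ w rfl A o b hb ho
  intro k
  induction k using Nat.strong_induction_on with
  | _ k ih =>
    intro w hk A o b hb ho
    by_cases hiso : ∀ y : Fin n, y ∉ A → y ≠ o → (w s(o, y) : ℝ) = 0
    · exact stub_goodBase stub_lemma5AnyRelay n w A o b hb ho hiso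
    · push Not at hiso
      refine goodStep_of_glueStep hglue n w A o b hb ho hiso ?_
      intro w' hw' A' o' b' hb' ho'
      exact ih _ (hk ▸ hw') w' rfl A' o' b' hb' ho'

/-- **`AdditiveGluing` from the gluing step.**  The line's composition (`AdditiveGluing_of` of the skeleton
`subuniform-dead-pocket-maximum`): if `t ≥ 1` the claim is trivial; otherwise pass to the level set
`A' = {x | 1 − t ≤ τ(x)} ⊇ A ∋ b`; if `o ∈ A'` then `μ(o ↔ A) − t ≤ 1 − t ≤ τ(o)`; else goodness of
`(w, A', o, b)` (`good_all_of_glueStep`, constant selection `b`) bounds the live failure by `t` after dropping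
the nonnegative dead-pocket penalty, and `{o ↔ A} ⊆ {o ↔ A', o ↮ b} ∪ {o ↔ b}`. -/
theorem additiveGluing_of_glueStep
    (hglue : ∀ (n : ℕ) (w : Sym2 (Fin n) → unitInterval) (A : Finset (Fin n)) (o x b a₀ : Fin n),
      b ∈ A → o ∉ A → x ∉ A → x ≠ o → w s(o, x) = 0 → a₀ ∈ A →
      (∀ a ∈ A, (prodBernoulli w).real (openConn a₀ b) ≤ (prodBernoulli w).real (openConn a b)) →
      (∀ (t : ℝ) (sel : Finset (Fin n) → Fin n), (∀ W, sel W ∈ A) →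
        (∀ a ∈ A, 1 - t ≤ (prodBernoulli w).real (openConn a b)) →
        ((prodBernoulli w).real ((⋃ a ∈ A, openConn o a) ∩ (openConn o b)ᶜ)
            + ∑ W ∈ (Finset.univ : Finset (Finset (Fin n))).filter (fun W => o ∈ W ∧ Disjoint W A),
                (prodBernoulli w).real {ω : BondConfig (Fin n) | openCluster ω o = (W : Set (Fin n))}
                  * (prodBernoulli w).real (openConnIn ((W : Set (Fin n))ᶜ) (sel W) b)ᶜ) ≤ t) →
      (∀ w' : Sym2 (Fin n) → unitInterval,
        (Finset.univ.filter (fun v : Fin n => ∃ u : Fin n, 0 < (w' s(u, v) : ℝ))).card < (Finset.univ.filter (fun v : Fin n => ∃ u : Fin n, 0 < (w s(u, v) : ℝ))).card →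
        ∀ (A' : Finset (Fin n)) (o' b' : Fin n), b' ∈ A' → o' ∉ A' →
        ∀ (t : ℝ) (sel : Finset (Fin n) → Fin n), (∀ W, sel W ∈ A') →
          (∀ a ∈ A', 1 - t ≤ (prodBernoulli w').real (openConn a b')) →
          ((prodBernoulli w').real ((⋃ a ∈ A', openConn o' a) ∩ (openConn o' b')ᶜ)
            + ∑ W ∈ (Finset.univ : Finset (Finset (Fin n))).filter (fun W => o' ∈ W ∧ Disjoint W A'),
                (prodBernoulli w').real {ω : BondConfig (Fin n) | openCluster ω o' = (W : Set (Fin n))}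
                  * (prodBernoulli w').real (openConnIn ((W : Set (Fin n))ᶜ) (sel W) b')ᶜ) ≤ t) →
      ∀ (sel : Finset (Fin n) → Fin n), (∀ W, sel W ∈ A) →
        ((prodBernoulli (Function.update w s(o, x) 1)).real ((⋃ a ∈ A, openConn o a) ∩ (openConn o b)ᶜ)
            + ∑ W ∈ (Finset.univ : Finset (Finset (Fin n))).filter (fun W => o ∈ W ∧ Disjoint W A),
                (prodBernoulli (Function.update w s(o, x) 1)).real {ω : BondConfig (Fin n) | openCluster ω o = (W : Set (Fin n))}
                  * (prodBernoulli (Function.update w s(o, x) 1)).real (openConnIn ((W : Set (Fin n))ᶜ) (sel W) b)ᶜ) ≤ 1 - (prodBernoulli (Function.update w s(o, x) 1)).real (openConn a₀ b)) :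
    Summit.CriticalPhenomena.PercolationContinuityZ3.Theses.PercNearOneGluing.AdditiveGluing := by
  intro n w A o b t ht hA
  have hU1 : (prodBernoulli w).real (⋃ a ∈ A, (openConn o a : Set (BondConfig (Fin n)))) ≤ 1 :=
    measureReal_le_one
  have hob0 : 0 ≤ (prodBernoulli w).real (openConn o b : Set (BondConfig (Fin n))) := measureReal_nonneg
  by_cases ht1 : 1 ≤ t
  · linarith
  push Not at ht1
  have hbb : (prodBernoulli w).real (openConn b b : Set (BondConfig (Fin n))) = 1 := by
    have h : (openConn b b : Set (BondConfig (Fin n))) = Set.univ :=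
      Set.eq_univ_of_forall fun ω => (SimpleGraph.Reachable.refl b : (openGraph ω).Reachable b b)
    rw [h, probReal_univ]
  have hbA' : b ∈ Finset.univ.filter (fun x : Fin n => 1 - t ≤ (prodBernoulli w).real (openConn x b)) := by
    rw [Finset.mem_filter]
    refine ⟨Finset.mem_univ _, ?_⟩
    rw [hbb]
    linarith
  have hAA' : ∀ a ∈ A, a ∈ Finset.univ.filter (fun x : Fin n => 1 - t ≤ (prodBernoulli w).real (openConn x b)) :=
    fun a ha => by
      rw [Finset.mem_filter]
      exact ⟨Finset.mem_univ _, hA a ha⟩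
  have hmemA' : ∀ x ∈ Finset.univ.filter (fun x : Fin n => 1 - t ≤ (prodBernoulli w).real (openConn x b)),
      1 - t ≤ (prodBernoulli w).real (openConn x b) := fun x hx => by
    rw [Finset.mem_filter] at hx
    exact hx.2
  by_cases ho : o ∈ Finset.univ.filter (fun x : Fin n => 1 - t ≤ (prodBernoulli w).real (openConn x b))
  · have := hmemA' o ho
    linarith
  have hgood := good_all_of_glueStep hglue n w
    (Finset.univ.filter (fun x : Fin n => 1 - t ≤ (prodBernoulli w).real (openConn x b))) o b hbA' ho t
    (fun _ => b) (fun _ => hbA') hmemA'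
  have hsum : 0 ≤ ∑ W ∈ (Finset.univ : Finset (Finset (Fin n))).filter (fun W => o ∈ W ∧
      Disjoint W (Finset.univ.filter (fun x : Fin n => 1 - t ≤ (prodBernoulli w).real (openConn x b)))),
        (prodBernoulli w).real {ω : BondConfig (Fin n) | openCluster ω o = (W : Set (Fin n))}
          * (prodBernoulli w).real (openConnIn ((W : Set (Fin n))ᶜ) ((fun _ => b) W) b)ᶜ :=
    Finset.sum_nonneg fun W _ => mul_nonneg measureReal_nonneg measureReal_nonneg
  have hlive : (prodBernoulli w).real
      ((⋃ a ∈ Finset.univ.filter (fun x : Fin n => 1 - t ≤ (prodBernoulli w).real (openConn x b)),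
        (openConn o a : Set (BondConfig (Fin n)))) ∩ (openConn o b)ᶜ) ≤ t := by
    linarith
  have hsub : (⋃ a ∈ A, (openConn o a : Set (BondConfig (Fin n)))) ⊆
      ((⋃ a ∈ Finset.univ.filter (fun x : Fin n => 1 - t ≤ (prodBernoulli w).real (openConn x b)),
        (openConn o a : Set (BondConfig (Fin n)))) ∩ (openConn o b)ᶜ) ∪ openConn o b := by
    intro ω hω
    by_cases hb : ω ∈ openConn o b
    · exact Or.inr hb
    · refine Or.inl ⟨?_, hb⟩
      simp only [Set.mem_iUnion] at hω ⊢
      obtain ⟨a, ha, hωa⟩ := hω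
      exact ⟨a, hAA' a ha, hωa⟩
  have hfin := (measureReal_mono (μ := prodBernoulli w) hsub).trans (measureReal_union_le _ _)
  linarith

/-- **Registered sub-goal `stub_additiveGluingOfGlueStep_k8`** (siege k8): the gluing step `GlueStep` implies
the crux `AdditiveGluing` by name (= `additiveGluing_of_glueStep`, one line). -/
theorem stub_additiveGluingOfGlueStep_k8 : (∀ (n : ℕ) (w : Sym2 (Fin n) → unitInterval) (A : Finset (Fin n)) (o x b a₀ : Fin n), b ∈ A → o ∉ A → x ∉ A → x ≠ o → w s(o, x) = 0 → a₀ ∈ A → (∀ a ∈ A, (prodBernoulli w).real (openConn a₀ b) ≤ (prodBernoulli w).real (openConn a b)) → (∀ (t : ℝ) (sel : Finset (Fin n) → Fin n), (∀ W, sel W ∈ A) → (∀ a ∈ A, 1 - t ≤ (prodBernoulli w).real (openConn a b)) → ((prodBernoulli w).real ((⋃ a ∈ A, openConn o a) ∩ (openConn o b)ᶜ) + ∑ W ∈ (Finset.univ : Finset (Finset (Fin n))).filter (fun W => o ∈ W ∧ Disjoint W A), (prodBernoulli w).real {ω : BondConfig (Fin n) | openCluster ω o = (W : Set (Fin n))}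 * (prodBernoulli w).real (openConnIn ((W : Set (Fin n))ᶜ) (sel W) b)ᶜ) ≤ t) → (∀ w' : Sym2 (Fin n) → unitInterval, (Finset.univ.filter (fun v : Fin n => ∃ u : Fin n, 0 < (w' s(u, v) : ℝ))).card < (Finset.univ.filter (fun v : Fin n => ∃ u : Fin n, 0 < (w s(u, v) : ℝ))).card → ∀ (A' : Finset (Fin n)) (o' b' : Fin n), b' ∈ A' → o' ∉ A' → ∀ (t : ℝ) (sel : Finset (Fin n) → Fin n), (∀ W, sel W ∈ A') → (∀ a ∈ A', 1 - t ≤ (prodBernoulli w').real (openConn a b')) → ((prodBernoulli w').real ((⋃ a ∈ A', openConn o' a) ∩ (openConn o' b')ᶜ) + ∑ W ∈ (Finset.univ : Finset (Finset (Fin n))).filter (fun W => o' ∈ W ∧ Disjoint W A'), (prodBernoulli w').real {ω : BondConfig (Fin n) | openCluster ω o' = (W : Set (Fin n))} * (prodBernoulli w').real (openConnIn ((W : Set (Fin n))ᶜ) (sel W) b')ᶜ) ≤ t) → ∀ (sel : Finset (Fin n) → Fin n), (∀ W, sel W ∈ A) → ((prodBernoulli (Function.update w s(o, x) 1)).real ((⋃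 a ∈ A, openConn o a) ∩ (openConn o b)ᶜ) + ∑ W ∈ (Finset.univ : Finset (Finset (Fin n))).filter (fun W => o ∈ W ∧ Disjoint W A), (prodBernoulli (Function.update w s(o, x) 1)).real {ω : BondConfig (Fin n) | openCluster ω o = (W : Set (Fin n))} * (prodBernoulli (Function.update w s(o, x) 1)).real (openConnIn ((W : Set (Fin n))ᶜ) (sel W) b)ᶜ) ≤ 1 - (prodBernoulli (Function.update w s(o, x) 1)).real (openConn a₀ b)) → Summit.CriticalPhenomena.PercolationContinuityZ3.Theses.PercNearOneGluing.AdditiveGluing :=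
  additiveGluing_of_glueStep

end

end Summit.CriticalPhenomena.PercolationContinuityZ3.Theorems
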